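import Mathlib
import HarnessLib
import Literature.Analysis.FluidPDE.Tao2016AveragedNS.TaylorChainCertificate
import Summits.NavierStokesRegularity.NavierStokesRegularity.Theorems.TaylorModelRungThreeReadoutChainTools

/-!
# Line `taylor-model` on crux K1b-DR (stmt-NavierStokesRegularity-23954) — stub G4 (`LandingC1`),
# helper 3: flow facts of an arbitrary flow package, in cascade and in window coordinates

Toward the registered stub `stub_landing : LandingC1` (skeleton v4 `a500375dfcc940c7`). Everything is
stated for an ARBITRARY `φ` with `IsFlowPackage cd φ` and uses only (F0) and (F2) (off-window zero,
unconditional uniqueness) together with K1b-DR's ODE clause shape `SolvesOn`: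

* `qT_congr_window` — the truncated field only sees the window; `stAt_congr_of_solvesOn`,
  `solvesOn_congr` — a solved datum and any datum agreeing with it on the window have the same flow;
* `solvesOn_shift`, `stAt_shift` — the FLOW PROPERTY on a solved horizon:
  `stAt φ j (stAt φ j z t₁) s = stAt φ j z (t₁ + s)`;
* window coordinates: the transported field `fW cd x := Qw cd x x` is a bounded bilinear map on the
  diagonal, hence `C^∞` (`contDiff_fW`); a solved trajectory read in window coordinates solves
  `u' = fW u` (`hasDerivWithinAt_toVec_stAt`); the section functional `σf j` read in window coordinates is a
  continuous linear functional `σfW`.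

MODEL-lattice bookkeeping only (rung TL-M3); nothing here is a statement about the Navier–Stokes equations.
-/

noncomputable section

-- the sub-problem namespace repeats the summit name by design (D-0017)
set_option linter.dupNamespace false

namespace Summit.NavierStokesRegularity.NavierStokesRegularity.Theorems.TaylorModelReadout.G4

open scoped BigOperators
open Set Finset Literature.Analysis.FluidPDE.TaoCascade Literature.Analysis.FluidPDE.TaoCascade.TaylorChain

variable {cd : CertData}

/-! ### The truncated field and solutions only see the window -/

/-- The truncated field only sees the window components of the state. [folklore] -/
theorem qT_congr_window {y y' : Fin 4 → ℤ → ℝ} (h : ∀ i k, -cd.Kb ≤ k → k ≤ cd.Ka → y i k = y' i k) :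
    cd.qT y = cd.qT y' := by
  have hfun : (fun j' n' (_ : ℝ) => if -cd.Kb ≤ n' ∧ n' ≤ cd.Ka then y j' n' else 0) =
      (fun j' n' (_ : ℝ) => if -cd.Kb ≤ n' ∧ n' ≤ cd.Ka then y' j' n' else 0) := by
    funext j' n' s
    by_cases hn : -cd.Kb ≤ n' ∧ n' ≤ cd.Ka
    · rw [if_pos hn, if_pos hn, h j' n' hn.1 hn.2]
    · rw [if_neg hn, if_neg hn]
  funext i k
  unfold CertData.qT
  rw [hfun]

/-- The `quadTerm` right-hand side of K1b-DR's ODE clause at time `t`, for two families agreeing on the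
window at time `t`, is the same. [folklore] -/
theorem quadTerm_trunc_congr {X Y : Fin 4 → ℤ → ℝ → ℝ} {t : ℝ}
    (h : ∀ i k, -cd.Kb ≤ k → k ≤ cd.Ka → X i k t = Y i k t) (i : Fin 4) {k : ℤ} (hk : -cd.Kb ≤ k ∧ k ≤ cd.Ka) :
    quadTerm 1 cd.α (fun j' n s' => if -cd.Kb ≤ n ∧ n ≤ cd.Ka then X j' n s' else 0) i k t =
      quadTerm 1 cd.α (fun j' n s' => if -cd.Kb ≤ n ∧ n ≤ cd.Ka then Y j' n s' else 0) i k t := by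
  rw [quadTerm_trunc_eq_qT (cd := cd) X i hk, quadTerm_trunc_eq_qT (cd := cd) Y i hk,
    qT_congr_window (fun i k h1 h2 => h i k h1 h2)]

variable {φ : Flow} (hF : IsFlowPackage cd φ) {j : ℕ} (hj : j ≤ cd.N₀)
include hF hj

/-- **Window congruence on a solved horizon** (F0 + F2): if `φ j z` solves on `[0, T]` and `z'` agrees with
`z` on the window, the flows from `z'` and `z` coincide on `[0, T]`. [folklore] -/
theorem stAt_congr_of_solvesOn {z z' : Fin 4 → ℤ → ℝ} {T : ℝ} (hsol : SolvesOn cd φ j z T) (hT : 0 ≤ T)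
    (hzz : ∀ i k, -cd.Kb ≤ k → k ≤ cd.Ka → z i k = z' i k) {t : ℝ} (ht : t ∈ Icc 0 T) :
    stAt φ j z' t = stAt φ j z t := by
  obtain ⟨h0, -, h2, -⟩ := hF j hj
  have hψ : ∀ i k, -cd.Kb ≤ k → k ≤ cd.Ka → φ j z i k 0 = z' i k ∧ ∀ t' ∈ Icc 0 T,
      HasDerivWithinAt (φ j z i k)
        (quadTerm 1 cd.α (fun j' n s' => if -cd.Kb ≤ n ∧ n ≤ cd.Ka then φ j z j' n s' else 0) i k t')
        (Icc 0 T) t' := by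
    intro i k hk1 hk2
    obtain ⟨a, b⟩ := hsol i k hk1 hk2
    exact ⟨a.trans (hzz i k hk1 hk2), b⟩
  have huniq := h2 z' T (fun i k => φ j z i k) hT hψ
  funext i k
  by_cases hk : -cd.Kb ≤ k ∧ k ≤ cd.Ka
  · exact (huniq i k hk.1 hk.2 t ht).symm
  · rw [stAt, stAt, h0 z i k hk t, h0 z' i k hk t]

/-- A datum agreeing on the window with a solved one is solved on the same horizon. [folklore] -/
theorem solvesOn_congr {z z' : Fin 4 → ℤ → ℝ} {T : ℝ} (hsol : SolvesOn cd φ j z T) (hT : 0 ≤ T)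
    (hzz : ∀ i k, -cd.Kb ≤ k → k ≤ cd.Ka → z i k = z' i k) : SolvesOn cd φ j z' T := by
  have heq : ∀ t ∈ Icc 0 T, ∀ i k, φ j z' i k t = φ j z i k t := fun t ht i k =>
    congrFun (congrFun (stAt_congr_of_solvesOn hF hj hsol hT hzz ht) i) k
  intro i k hk1 hk2
  obtain ⟨a, b⟩ := hsol i k hk1 hk2
  have h0T : (0:ℝ) ∈ Icc 0 T := ⟨le_rfl, hT⟩
  refine ⟨by rw [heq 0 h0T, a, hzz i k hk1 hk2], fun t' ht' => ?_⟩
  have hb := b t' ht'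
  rw [quadTerm_trunc_congr (X := fun j' n s' => φ j z j' n s') (Y := fun j' n s' => φ j z' j' n s')
    (fun i' k' h1 h2 => (heq t' ht' i' k').symm) i ⟨hk1, hk2⟩] at hb
  exact hb.congr_of_mem (fun t ht => heq t ht i k) ht'

/-- **Flow property, part 1**: the state at time `t₁` of a trajectory solved on `[0, T]` is a solved datum
on `[0, T − t₁]`. [folklore] -/
theorem solvesOn_shift {z : Fin 4 → ℤ → ℝ} {T t₁ : ℝ} (hsol : SolvesOn cd φ j z T) (h0 : 0 ≤ t₁)
    (h1 : t₁ ≤ T) : SolvesOn cd φ j (stAt φ j z t₁) (T - t₁) ∧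
      ∀ s ∈ Icc 0 (T - t₁), stAt φ j (stAt φ j z t₁) s = stAt φ j z (t₁ + s) := by
  obtain ⟨h0F, -, h2, -⟩ := hF j hj
  -- the shifted trajectory solves from the state at `t₁`
  set ψ : Fin 4 → ℤ → ℝ → ℝ := fun i k s => φ j z i k (t₁ + s) with hψdef
  have hψ : ∀ i k, -cd.Kb ≤ k → k ≤ cd.Ka → ψ i k 0 = stAt φ j z t₁ i k ∧ ∀ s ∈ Icc 0 (T - t₁),
      HasDerivWithinAt (ψ i k)
        (quadTerm 1 cd.α (fun j' n s' => if -cd.Kb ≤ n ∧ n ≤ cd.Ka then ψ j' n s' else 0) i k s)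
        (Icc 0 (T - t₁)) s := by
    intro i k hk1 hk2
    refine ⟨by simp [hψdef, stAt], fun s hs => ?_⟩
    have hts : t₁ + s ∈ Icc 0 T := ⟨by linarith [hs.1], by linarith [hs.2]⟩
    have hd := (hsol i k hk1 hk2).2 (t₁ + s) hts
    have hinner : HasDerivWithinAt (fun s : ℝ => t₁ + s) 1 (Icc 0 (T - t₁)) s :=
      (hasDerivWithinAt_id s _).const_add t₁
    have hmaps : MapsTo (fun s : ℝ => t₁ + s) (Icc 0 (T - t₁)) (Icc 0 T) := fun s hs =>
      ⟨by linarith [hs.1], by linarith [hs.2]⟩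
    have hcomp := hd.comp s hinner hmaps
    rw [mul_one] at hcomp
    have hval : quadTerm 1 cd.α (fun j' n s' => if -cd.Kb ≤ n ∧ n ≤ cd.Ka then φ j z j' n s' else 0) i k (t₁ + s)
        = quadTerm 1 cd.α (fun j' n s' => if -cd.Kb ≤ n ∧ n ≤ cd.Ka then ψ j' n s' else 0) i k s := by
      rw [quadTerm_trunc_eq_qT (cd := cd) _ i ⟨hk1, hk2⟩, quadTerm_trunc_eq_qT (cd := cd) _ i ⟨hk1, hk2⟩]
    rw [hval] at hcomp
    exact hcomp
  have hT' : 0 ≤ T - t₁ := by linarith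
  have huniq := h2 (stAt φ j z t₁) (T - t₁) ψ hT' hψ
  have heq : ∀ s ∈ Icc 0 (T - t₁), stAt φ j (stAt φ j z t₁) s = stAt φ j z (t₁ + s) := by
    intro s hs
    funext i k
    by_cases hk : -cd.Kb ≤ k ∧ k ≤ cd.Ka
    · have := huniq i k hk.1 hk.2 s hs
      simp only [stAt, hψdef] at this ⊢
      exact this.symm
    · simp only [stAt, h0F _ i k hk]
  refine ⟨?_, heq⟩
  intro i k hk1 hk2
  refine ⟨?_, fun s hs => ?_⟩
  · have := congrFun (congrFun (heq 0 ⟨le_rfl, hT'⟩) i) k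
    simp only [stAt, add_zero] at this
    exact this
  · have hd := (hψ i k hk1 hk2).2 s hs
    have hfun : ∀ s' ∈ Icc 0 (T - t₁), φ j (stAt φ j z t₁) i k s' = ψ i k s' := fun s' hs' => by
      have := congrFun (congrFun (heq s' hs') i) k
      simpa [stAt, hψdef] using this
    rw [quadTerm_trunc_congr (X := ψ) (Y := fun j' n s' => φ j (stAt φ j z t₁) j' n s')
      (fun i' k' _ _ => by
        have := congrFun (congrFun (heq s hs) i') k'
        simpa [stAt, hψdef] using this.symm) i ⟨hk1, hk2⟩] at hd
    exact hd.congr_of_mem hfun hs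

omit hF hj in
/-- **A solved trajectory read in window coordinates solves `u' = Qw u u`.** [folklore] -/
theorem hasDerivWithinAt_toVec_stAt {z : Fin 4 → ℤ → ℝ} {T : ℝ} (hsol : SolvesOn cd φ j z T) {t : ℝ}
    (ht : t ∈ Icc 0 T) :
    HasDerivWithinAt (fun s => toVec cd (stAt φ j z s))
      (Qw cd (toVec cd (stAt φ j z t)) (toVec cd (stAt φ j z t))) (Icc 0 T) t := by
  refine hasDerivWithinAt_pi.2 fun c => ?_
  have hk := shellOf_mem cd c
  have h1 := (hsol (modeOf cd c) (shellOf cd c) hk.1 hk.2).2 t ht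
  rw [quadTerm_trunc_eq_qT (cd := cd) _ _ hk, qT_eq_Qw_apply (cd := cd) _ _ hk] at h1
  have hc : eW cd (modeOf cd c, ⟨shellOf cd c, Finset.mem_Icc.2 hk⟩) = c := Equiv.apply_symm_apply (eW cd) c
  rw [hc] at h1
  exact h1

omit hF hj in
/-- A solved trajectory starts at (the window part of) its datum. [folklore] -/
theorem toVec_stAt_zero {z : Fin 4 → ℤ → ℝ} {T : ℝ} (hsol : SolvesOn cd φ j z T) :
    toVec cd (stAt φ j z 0) = toVec cd z := by
  funext c
  have hk := shellOf_mem cd c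
  exact (hsol (modeOf cd c) (shellOf cd c) hk.1 hk.2).1

/-- A solved trajectory is window-supported and hence recovered from its window coordinates. [folklore] -/
theorem ofVec_toVec_stAt (z : Fin 4 → ℤ → ℝ) (t : ℝ) : ofVec cd (toVec cd (stAt φ j z t)) = stAt φ j z t :=
  ofVec_toVec_of_wsupp cd (stAt_off_window hF hj z t)

end Summit.NavierStokesRegularity.NavierStokesRegularity.Theorems.TaylorModelReadout.G4

/-! ### Window coordinates: the transported field is smooth; functionals are continuous -/

namespace Summit.NavierStokesRegularity.NavierStokesRegularity.Theorems.TaylorModelReadout.G4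

open Set Literature.Analysis.FluidPDE.TaoCascade Literature.Analysis.FluidPDE.TaoCascade.TaylorChain

variable (cd : CertData)

/-- The transported truncated field on the diagonal: `fW x = Qw x x` (the right-hand side of the window
ODE). [folklore] -/
def fW (x : Fin (nW cd) → ℝ) : Fin (nW cd) → ℝ := Qw cd x x

/-- `Qw` as a bilinear map. [folklore] -/
def QwL : (Fin (nW cd) → ℝ) →ₗ[ℝ] (Fin (nW cd) → ℝ) →ₗ[ℝ] (Fin (nW cd) → ℝ) :=
  LinearMap.mk₂ ℝ (Qw cd) (fun u u' v => (isLinearMap_Qw_left cd v).map_add u u')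
    (fun r u v => (isLinearMap_Qw_left cd v).map_smul r u) (fun u v v' => (isLinearMap_Qw_right cd u).map_add v v')
    (fun r u v => (isLinearMap_Qw_right cd u).map_smul r v)

/-- `Qw` as a continuous bilinear map (finite dimension). [folklore] -/
def QwCL : (Fin (nW cd) → ℝ) →L[ℝ] (Fin (nW cd) → ℝ) →L[ℝ] (Fin (nW cd) → ℝ) :=
  LinearMap.toContinuousLinearMap
    ((LinearMap.toContinuousLinearMap :
        ((Fin (nW cd) → ℝ) →ₗ[ℝ] (Fin (nW cd) → ℝ)) ≃ₗ[ℝ] ((Fin (nW cd) → ℝ) →L[ℝ] (Fin (nW cd) → ℝ))).toLinearMap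
      ∘ₗ QwL cd)

/-- `QwCL u v = Qw u v`. [folklore] -/
@[simp] theorem QwCL_apply (u v : Fin (nW cd) → ℝ) : QwCL cd u v = Qw cd u v := rfl

/-- The diagonal field is `C^∞`. [folklore] -/
theorem contDiff_fW {n : WithTop ℕ∞} : ContDiff ℝ n (fW cd) := by
  have hb : IsBoundedBilinearMap ℝ (fun p : (Fin (nW cd) → ℝ) × (Fin (nW cd) → ℝ) => QwCL cd p.1 p.2) :=
    (QwCL cd).isBoundedBilinearMap
  have h := hb.contDiff.comp (contDiff_id.prodMk contDiff_id) (n := n)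
  exact h

/-- The diagonal field is continuous. [folklore] -/
theorem continuous_fW : Continuous (fW cd) := (contDiff_fW cd (n := 0)).continuous

/-- Zero extension of window coordinates as a linear map. [folklore] -/
def ofVecL : (Fin (nW cd) → ℝ) →ₗ[ℝ] (Fin 4 → ℤ → ℝ) where
  toFun := ofVec cd
  map_add' := ofVec_add cd
  map_smul' := ofVec_smul cd

/-- `ofVecL x = ofVec x`. [folklore] -/
@[simp] theorem ofVecL_apply (x : Fin (nW cd) → ℝ) : ofVecL cd x = ofVec cd x := rfl

/-- A linear functional of shell states, read on window coordinates, as a continuous linear functional.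
[folklore] -/
def clmW (L : (Fin 4 → ℤ → ℝ) →ₗ[ℝ] ℝ) : (Fin (nW cd) → ℝ) →L[ℝ] ℝ :=
  LinearMap.toContinuousLinearMap (L ∘ₗ ofVecL cd)

/-- `clmW L x = L (ofVec x)`. [folklore] -/
@[simp] theorem clmW_apply (L : (Fin 4 → ℤ → ℝ) →ₗ[ℝ] ℝ) (x : Fin (nW cd) → ℝ) : clmW cd L x = L (ofVec cd x) := rfl

end Summit.NavierStokesRegularity.NavierStokesRegularity.Theorems.TaylorModelReadout.G4

end
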